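import Summits.ResolutionOfSingularities.ResolutionOfSingularities.Theses.PAlteration
import Literature.Barriers.ResolutionOfSingularities.InseparableBaseChangeResolution
import Literature.AlgebraicGeometry.Resolution.ProjectiveSpaceRegular

/-!
# Disproof of `PicoverToRadicialBottom` (stmt-ResolutionOfSingularities-0556) — findings

Work file of the crux disprover (cdisprove). Crux, by name:
`PicoverToRadicialBottom : ∀ p prime, PicoverAt p → RadicialBottomAt p` (this file's
`picoverToRadicialBottom_iff`), where `PicoverAt p` is the route's rank-2 crux at the prime `p`
(finite radicial covers of regular varieties have resolutions) and `RadicialBottomAt p` says: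
`g : X'' → X` finite, universally injective, surjective, `X, X''` integral, `X` separated of
finite type over a field of characteristic `p`, `HasResolution X'' → HasResolution X`.

FINDINGS (numbers, not adjectives):
1. NO UNCONDITIONAL KILL IS POSSIBLE WITH PRESENT KNOWLEDGE (`refutationCost`): a proof of
   `¬ PicoverToRadicialBottom` yields BOTH (a) a prime `p` with `PicoverAt p` (the route's own open
   rank-2 crux, positive direction) and (b) `¬ ResolutionOfSingularities` (an integral separated
   finite-type scheme over a field with no resolution — no such scheme is known in any
   characteristic). Equivalently the summit implies the crux. So the crux is un-refutable short of
   refuting the summit, and un-provable (as far as anyone knows) in the regime `[k : k^p] = ∞`.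
   WLOG `dim X ≥ 4` modulo the named fact `CossartPiltant2019`
   (`picoverToRadicialBottom_iff_dim_gt_three`).
2. LOAD-BEARING HYPOTHESES. Of the nine hypotheses of `RadicialBottomAt`, every variant obtained
   by dropping one still concludes `HasResolution X` for an `X` that is (or may be taken) integral
   of finite type over a field, hence is again summit-implied and un-refutable — EXCEPT
   `IsIntegral X`: dropping it admits the non-reduced point `X = Spec k[ε]` under the closed
   immersion `g : Spec k → Spec k[ε]` (finite, universally injective, surjective, source its own
   resolution), and `Spec k[ε]` has no resolution. Proved for every prime:
   `not_radicialBottomAtWithoutIntegral`; crux-shaped corollary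
   `withoutIntegral_iff_not_picover` (dropping `IsIntegral X` turns the crux into
   `∀ p prime, ¬ PicoverAt p`, the negation of the route's rank-2 crux).
   Refinement: given the other hypotheses, `IsIntegral X` is equivalent to `IsReduced X`
   (`isIntegral_of_isReduced_of_surjective`): only generic reducedness of `X` is load-bearing.
   `IsIntegral X''` is NOT load-bearing: `g` is a homeomorphism, so it is implied by `IsReduced X''`
   (`isIntegral_top_of_isReduced`), and on paper even that is removable via `X''_red`.
   §2b: with `HasResolution X''` dropped (take `g = 𝟙`) the consequent family over all primes IS
   the summit (`withoutResolution_iff_summit`, via the route's proved `DescentReducedToIntegral`);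
   `p.Prime` is decoration modulo characteristic `0` (`withoutPrime_iff`). Every other single
   drop still concludes `HasResolution X` for an integral finite-type `X/k`: summit-implied,
   un-refutable (table in §3).
3. WHY IT RESISTS A PROOF (for the provers; prose in §4): absolute-Frobenius factor
   `h : X → X''` is finite iff `[k : k^p] < ∞`; the RELATIVE Frobenius `F_{X''/k}` is always finite
   but its target's resolution is the Frobenius twist `X̃''^{(q)} ≅ X̃'' ⊗ₖ k^{1/q}`, not regular
   (catalogued: `Literature.Barriers.ResolutionOfSingularities.FrobeniusTwistResolution`,
   `…RegularNotGeometricallyRegular`); descent to an F-finite subfield `k₁ ⊆ k` followed by the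
   base change `k₁ → k` needs `k/k₁` separable, and §4 records a field `k` (char `p`,
   `[k : k^p] = ∞`) with two elements `a, b` such that the ONLY subfield `k₁ ∋ a, b` with `k/k₁`
   separable is `k` itself (`exists_field_no_FFinite_separable_subfield`, paper proof in the
   docstring, Lean `sorry`: Mathlib has no p-bases / separable transcendental extensions).
4. Targets: none this cycle (payload `stuck_stubs = []`).
5. LANDED / FILED from this work file (all sorry-free, no defs):
   * `Theorems/PicoverToRadicialBottom/Negative/LoadBearing.lean` (p89456 ACCEPTED): §1–§2b of this
     file at the crux's literal binder list — `not_resolutionOfSingularities_of_not_picoverToRadicialBottom`,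
     `exists_picover_of_not_picoverToRadicialBottom`, `radicialBottom_false_without_isIntegral_at`,
     `picoverToRadicialBottom_without_isIntegral_iff`, `radicialBottom_without_hasResolution_iff_summit`,
     `isIntegral_of_isReduced_of_surjective`.
   * `Theorems/PicoverToRadicialBottom/Negative/RadicialCoverCriteria.lean` (p91560 ACCEPTED):
     POSITIVE-SIDE CERTIFICATES for the hypothesis `UniversallyInjective g` —
     `universallyInjective_SpecMap_of_ideal_le_nilradical` (kernel of `S ⊗_R S → S` nil ⇒ UI,
     Stacks 01S4), `kaehlerIdeal_le_nilradical_of_adjoin_singleton`, `tmul_sub_pow_three_eq_zero`,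
     `universallyInjective_SpecMap_of_pow_char_mem_range` (char `p`, `S = B[s]`, `s^p ∈ B` ⇒ UI),
     `universallyInjective_SpecMap_adjoinRoot_X_pow_char_sub_C` (the `α_p`-cover
     `Spec B[t]/(t^p − f) → Spec B`, `B` a domain, is UI), and the cusp normalisation
     `Spec K[T] → Spec K[T², T³]` finite + UI + surjective.
   * `Theorems/PicoverToRadicialBottom/Negative/RegularityNotDescending.lean` (p91846 ACCEPTED):
     `radicialBottom_strengthening_isRegular_false` — the STRENGTHENING of the consequent with
     `Scheme.IsRegular` for `Scheme.HasResolution` on both sides ("regularity descends along finite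
     UI surjective maps of integral varieties") is FALSE at every prime (cusp normalisation
     `Spec 𝔽_p[T] → Spec 𝔽_p[T², T³]`).
   (p91560 is ACCEPTED as well.)
-/

noncomputable section

set_option linter.dupNamespace false

namespace Summit.ResolutionOfSingularities.ResolutionOfSingularities.Cruxes.PicoverToRadicialBottom.Disproof

open AlgebraicGeometry CategoryTheory Literature.AlgebraicGeometry.Resolution
open Summit.ResolutionOfSingularities.ResolutionOfSingularities.Theses.PAlteration
open Literature.Barriers.ResolutionOfSingularities

/-! ## §0 The crux by name -/

/-- `PICover_p`: the route's rank-2 crux `Picover` at a fixed prime `p` (the antecedent of the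
crux). [folklore] -/
def PicoverAt (p : ℕ) : Prop :=
  ∀ (k : Type) [Field k] [CharP k p] (Y X : Scheme.{0}) (f : Y ⟶ Spec (.of k)) (g : X ⟶ Y),
    IsSeparated f → LocallyOfFiniteType f → QuasiCompact f → IsIntegral Y → Scheme.IsRegular Y →
      IsIntegral X → IsFinite g → UniversallyInjective g → Function.Surjective g.base →
        Scheme.HasResolution X

/-- `RadicialBottom_p`: the consequent of the crux at a fixed prime `p`. [folklore] -/
def RadicialBottomAt (p : ℕ) : Prop :=
  ∀ (k : Type) [Field k] [CharP k p] (X X'' : Scheme.{0}) (f : X ⟶ Spec (.of k)) (g : X'' ⟶ X),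
    IsSeparated f → LocallyOfFiniteType f → QuasiCompact f → IsIntegral X → IsIntegral X'' →
      IsFinite g → UniversallyInjective g → Function.Surjective g.base →
        Scheme.HasResolution X'' → Scheme.HasResolution X

/-- The crux is literally `∀ p prime, PicoverAt p → RadicialBottomAt p`. [folklore] -/
theorem picoverToRadicialBottom_iff :
    PicoverToRadicialBottom ↔ ∀ p : ℕ, p.Prime → PicoverAt p → RadicialBottomAt p :=
  Iff.rfl

/-- The route's rank-2 crux is literally `∀ p prime, PicoverAt p`. [folklore] -/
theorem picover_iff : Picover ↔ ∀ p : ℕ, p.Prime → PicoverAt p :=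
  Iff.rfl

/-! ## §1 Refutation cost: a kill needs `PicoverAt p` AND a counterexample to the summit -/

/-- The consequent at `p` is an instance of the summit conjunct `ResolutionInChar p` (an integral
scheme is reduced). [folklore] -/
theorem radicialBottomAt_of_resolutionInChar {p : ℕ} (h : ResolutionInChar.{0} p) :
    RadicialBottomAt p := by
  intro k _ _ X X'' f g hsep hft hqc hX _ _ _ _ _
  exact h k X f hsep hft hqc inferInstance

/-- Hence a failure of the consequent at a prime `p` refutes the summit. [folklore] -/
theorem not_resolutionOfSingularities_of_not_radicialBottomAt {p : ℕ} (hp : p.Prime)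
    (h : ¬ RadicialBottomAt p) : ¬ _root_.ResolutionOfSingularities := fun hS =>
  h (radicialBottomAt_of_resolutionInChar (hS p hp))

/-- **Refutation cost.** Any proof of `¬ PicoverToRadicialBottom` produces a prime `p` at which
the route's open rank-2 crux `PicoverAt p` HOLDS and the consequent fails, and in particular
refutes the summit `ResolutionOfSingularities` itself. [folklore] -/
theorem refutationCost (h : ¬ PicoverToRadicialBottom) :
    (∃ p : ℕ, p.Prime ∧ PicoverAt p ∧ ¬ RadicialBottomAt p) ∧ ¬ _root_.ResolutionOfSingularities := by
  have h' : ∃ p : ℕ, p.Prime ∧ PicoverAt p ∧ ¬ RadicialBottomAt p := by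
    by_contra hne
    apply h
    intro p hp hP
    by_contra hRB
    exact hne ⟨p, hp, hP, hRB⟩
  obtain ⟨p, hp, hP, hRB⟩ := h'
  exact ⟨⟨p, hp, hP, hRB⟩, not_resolutionOfSingularities_of_not_radicialBottomAt hp hRB⟩

/-- Contrapositive packaging: the summit implies the crux (so `¬ crux` is at least as hard as
`¬ summit`). Stated negatively. [folklore] -/
theorem not_resolutionOfSingularities_of_not_picoverToRadicialBottom
    (h : ¬ PicoverToRadicialBottom) : ¬ _root_.ResolutionOfSingularities :=
  (refutationCost h).2

/-- **WLOG `dim X ≥ 4`** (modulo the named fact `CossartPiltant2019`, dimension `≤ 3` over every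
field, in tree as `hasResolution_of_dim_le_three`): the crux is equivalent to its restriction to
bottoms `X` of topological Krull dimension `> 3` — below that the consequent holds outright,
whatever `X''` and `g` are. So any content (and any counterexample) lives in dimension `≥ 4`, in
the regime `[k : k^p] = ∞` of §3. [cite: CossartPiltant2019, Thm. 1.1] -/
theorem picoverToRadicialBottom_iff_dim_gt_three (hCP : CossartPiltant2019.{0}) :
    PicoverToRadicialBottom ↔
      ∀ p : ℕ, p.Prime → PicoverAt p →
        ∀ (k : Type) [Field k] [CharP k p] (X X'' : Scheme.{0}) (f : X ⟶ Spec (.of k))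
          (g : X'' ⟶ X), IsSeparated f → LocallyOfFiniteType f → QuasiCompact f → IsIntegral X →
            IsIntegral X'' → IsFinite g → UniversallyInjective g → Function.Surjective g.base →
              Scheme.HasResolution X'' → 3 < topologicalKrullDim ↥X → Scheme.HasResolution X := by
  refine ⟨fun h p hp hP k _ _ X X'' f g h1 h2 h3 h4 h5 h6 h7 h8 h9 _ =>
    h p hp hP k X X'' f g h1 h2 h3 h4 h5 h6 h7 h8 h9, fun h p hp hP k _ _ X X'' f g h1 h2 h3 h4 h5 h6 h7 h8 h9 => ?_⟩
  by_cases hdim : topologicalKrullDim ↥X ≤ 3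
  · haveI := h1; haveI := h2; haveI := h3; haveI := h4
    exact hasResolution_of_dim_le_three (p := p) hCP k X f hdim
  · exact h p hp hP k X X'' f g h1 h2 h3 h4 h5 h6 h7 h8 h9 (not_le.mp hdim)

/-! ## §2 Load-bearing analysis: `IsIntegral X` -/

/-- The consequent with the hypothesis `IsIntegral X` DROPPED (everything else kept, including
`IsIntegral X''` and `HasResolution X''`). [folklore] -/
def RadicialBottomAtWithoutIntegral (p : ℕ) : Prop :=
  ∀ (k : Type) [Field k] [CharP k p] (X X'' : Scheme.{0}) (f : X ⟶ Spec (.of k)) (g : X'' ⟶ X),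
    IsSeparated f → LocallyOfFiniteType f → QuasiCompact f → IsIntegral X'' →
      IsFinite g → UniversallyInjective g → Function.Surjective g.base →
        Scheme.HasResolution X'' → Scheme.HasResolution X

/-- The crux with `IsIntegral X` dropped from its consequent. [folklore] -/
def PicoverToRadicialBottomWithoutIntegral : Prop :=
  ∀ p : ℕ, p.Prime → PicoverAt p → RadicialBottomAtWithoutIntegral p

section Witness

variable (k : Type) [Field k]

/-- The witness bottom `X = Spec k[ε]`. -/
abbrev thickPt : Scheme.{0} := Spec (.of (DualNumber k))

/-- Its structure map `Spec k[ε] → Spec k`. -/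
abbrev thickStr : thickPt k ⟶ Spec (.of k) :=
  Spec.map (CommRingCat.ofHom (algebraMap k (DualNumber k)))

/-- The witness cover `g : Spec k → Spec k[ε]` (the closed immersion `ε ↦ 0`). -/
abbrev redImm : Spec (.of k) ⟶ thickPt k :=
  Spec.map (CommRingCat.ofHom (TrivSqZeroExt.fstHom k k k).toRingHom)

instance isClosedImmersion_redImm : IsClosedImmersion (redImm k) :=
  IsClosedImmersion.spec_of_surjective _ fun a => ⟨TrivSqZeroExt.inl a, by simp⟩

instance subsingleton_thickPt : Subsingleton ↥(thickPt k) :=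
  subsingleton_primeSpectrum_of_isUnit_or_isNilpotent TrivSqZeroExt.isUnit_or_isNilpotent

theorem surjective_redImm : Function.Surjective (redImm k).base := fun _ =>
  ⟨(⟨⊥, Ideal.isPrime_bot⟩ : PrimeSpectrum k), Subsingleton.elim _ _⟩

end Witness

/-- **`IsIntegral X` is load-bearing**: for EVERY prime `p` the consequent without it is false.
Witness over `k = 𝔽_p`: `X = Spec k[ε]`, `X'' = Spec k`, `g` the closed immersion `ε ↦ 0`
(finite, universally injective as a monomorphism, surjective onto the one-point space), `X''`
regular hence its own resolution, while `Spec k[ε]` has no resolution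
(`not_hasResolution_Spec_dualNumber`: a one-point scheme with a resolution is reduced).
[folklore] -/
theorem not_radicialBottomAtWithoutIntegral (p : ℕ) [Fact p.Prime] :
    ¬ RadicialBottomAtWithoutIntegral p := by
  intro h
  refine not_hasResolution_Spec_dualNumber (ZMod p) ?_
  exact h (ZMod p) (thickPt (ZMod p)) (Spec (.of (ZMod p))) (thickStr (ZMod p)) (redImm (ZMod p))
    inferInstance (locallyOfFiniteType_Spec_dualNumber (ZMod p)) inferInstance inferInstance
    inferInstance inferInstance (surjective_redImm (ZMod p))
    (Scheme.isRegular_Spec (CommRingCat.of (ZMod p))).hasResolution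

/-- Crux-shaped corollary: with `IsIntegral X` dropped, the crux is EQUIVALENT to the failure of
the route's rank-2 crux at every prime — i.e. any proof of the crux must use `IsIntegral X`
unless it refutes `Picover`. [folklore] -/
theorem withoutIntegral_iff_not_picover :
    PicoverToRadicialBottomWithoutIntegral ↔ ∀ p : ℕ, p.Prime → ¬ PicoverAt p := by
  refine ⟨fun h p hp hP => ?_, fun h p hp hP => absurd hP (h p hp)⟩
  haveI : Fact p.Prime := ⟨hp⟩
  exact not_radicialBottomAtWithoutIntegral p (h p hp hP)

/-- Refinement: in the presence of `IsIntegral X''` and `Function.Surjective g.base`, the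
hypothesis `IsIntegral X` is equivalent to `IsReduced X` (the continuous image of an irreducible
space is irreducible) — only GENERIC reducedness of `X` is load-bearing; embedded nilpotents of
`X` off a dense open are not excluded by `HasResolution` at all. [folklore] -/
theorem isIntegral_of_isReduced_of_surjective {X X'' : Scheme.{0}} (g : X'' ⟶ X)
    [IsIntegral X''] [IsReduced X] (hg : Function.Surjective g.base) : IsIntegral X := by
  haveI : IrreducibleSpace X := hg.irreducibleSpace g.base.hom.continuous
  exact isIntegral_of_irreducibleSpace_of_isReduced X

/-- Refinement for the TOP: given `IsIntegral X` and `g` finite, universally injective and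
surjective, `g` is a homeomorphism (closed continuous bijection), so `IsIntegral X''` is implied by
`IsReduced X''`; and on paper even reducedness of `X''` is removable (a resolution `Z → X''`
factors through `X''_red`, which is integral, finite radicial surjective over `X`, and resolved by
`Z`; `X_red` is not available in Mathlib). So `IsIntegral X''` is NOT load-bearing. [folklore] -/
theorem isIntegral_top_of_isReduced {X X'' : Scheme.{0}} (g : X'' ⟶ X) [IsIntegral X]
    [IsReduced X''] [IsFinite g] [UniversallyInjective g] (hg : Function.Surjective g.base) :
    IsIntegral X'' := by
  have hce : Topology.IsClosedEmbedding g.base :=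
    .of_continuous_injective_isClosedMap g.base.hom.continuous g.injective g.isClosedMap
  let e : ↥X'' ≃ₜ ↥X :=
    (Equiv.ofBijective g.base ⟨g.injective, hg⟩).toHomeomorphOfIsInducing hce.isInducing
  haveI : IrreducibleSpace X'' := e.irreducibleSpace_iff.mpr inferInstance
  exact isIntegral_of_irreducibleSpace_of_isReduced X''

/-! ## §2b Load-bearing analysis: `HasResolution X''` and `p.Prime` -/

/-- The consequent with the hypothesis `HasResolution X''` DROPPED. [folklore] -/
def RadicialBottomAtWithoutResolution (p : ℕ) : Prop :=
  ∀ (k : Type) [Field k] [CharP k p] (X X'' : Scheme.{0}) (f : X ⟶ Spec (.of k)) (g : X'' ⟶ X),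
    IsSeparated f → LocallyOfFiniteType f → QuasiCompact f → IsIntegral X → IsIntegral X'' →
      IsFinite g → UniversallyInjective g → Function.Surjective g.base → Scheme.HasResolution X

/-- **`HasResolution X''` is load-bearing modulo the summit**: with it dropped (take `g = 𝟙 X`),
the family of consequents over all primes is literally EQUIVALENT to the summit
`ResolutionOfSingularities` (reduced → integral by the route's proved support item
`DescentReducedToIntegral_holds`). So without it the crux reads "PICover ⇒ summit", i.e. it would
BE the assembly. [folklore] -/
theorem withoutResolution_iff_summit :
    (∀ p : ℕ, p.Prime → RadicialBottomAtWithoutResolution p) ↔ _root_.ResolutionOfSingularities := by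
  constructor
  · intro h p hp k _ _ X f hsep hft hqc hred
    refine DescentReducedToIntegral_holds k (fun Y fY hYsep hYft hYqc hY => ?_) X f hsep hft hqc hred
    exact h p hp k Y Y fY (𝟙 Y) hYsep hYft hYqc hY hY inferInstance inferInstance
      (fun y => ⟨y, rfl⟩)
  · intro hS p hp k _ _ X X'' f g hsep hft hqc _ _ _ _ _
    exact hS p hp k X f hsep hft hqc inferInstance

/-- **`p.Prime` is decoration modulo characteristic `0`**: with it dropped the crux is its own
conjunction with the characteristic-`0` instance (no field has characteristic `1` or a composite
characteristic, `CharP.char_is_prime_or_zero`); the characteristic-`0` instance is implied by the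
named fact `Hironaka1964` (not used here). [folklore] -/
theorem withoutPrime_iff :
    (∀ p : ℕ, PicoverAt p → RadicialBottomAt p) ↔
      (PicoverAt 0 → RadicialBottomAt 0) ∧ PicoverToRadicialBottom := by
  refine ⟨fun h => ⟨h 0, fun p _ => h p⟩, fun ⟨h0, hcrux⟩ p hP => ?_⟩
  by_cases hp : p.Prime
  · exact hcrux p hp hP
  · rcases Nat.eq_zero_or_pos p with rfl | hpos
    · exact h0 hP
    · intro k _ _ X X'' f g _ _ _ _ _ _ _ _ _
      rcases CharP.char_is_prime_or_zero k p with h' | h'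
      · exact absurd h' hp
      · omega

/-! ## §3 Why the crux resists a PROOF when `[k : k^p] = ∞` (briefing for provers; prose only)

Setting: `k` of characteristic `p`, `X` normal integral separated of finite type over `k`
(normalise first: `Scheme.HasResolution.of_normalization`), `g : X'' → X` finite radicial
surjective, `X''` integral, `π'' : Z → X''` a resolution, `K := K(X) ⊆ K'' := K(X'')`,
`K''^q ⊆ K` for some `q = p^m`. PICover is available over EVERY field of characteristic `p`.
Every strategy tried funnels into the same arithmetic — a map is finite iff `[k : k^p] < ∞`:

* (A) ABSOLUTE Frobenius factor `h : X → X''`, `h ∘ g = F^m` (exists for normal `X`: affine-locally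
  `B^q ⊆ B ∩ K = A`; Stacks 0CNF, Kollár 1997 Prop. 6.6, Temkin 2013 Rem. 1.3.5 (i)). Pull back `Z`
  along `h`; `(X ×_{X''} Z)_red → Z` is integral, radicial, surjective, and FINITE iff `A` is a
  finite `B^q`-module iff `[k : k^p] < ∞`. For F-finite `k` this proves the crux on paper (route
  review note of refuter rreview1-pAlt-0 on the item, 2026-08-15, re-verified here).
* (B) RELATIVE Frobenius `F_{X''/k}^m : X'' → X''^{(q)}` IS finite for every `k` and factors through
  `g` (image of `B ⊗_{k,F^m} k → B` is `k[B^q] ⊆ A`, and `A` is a finite `k[B^q]`-module), but the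
  target's resolution is the TWIST `Z^{(q)} = Z ×_{k,F^m} k ≅ Z ⊗ₖ k^{1/q}`, which is not regular
  (not even reduced) in general: `Literature.Barriers.ResolutionOfSingularities.FrobeniusTwistResolution`,
  `…RegularNotGeometricallyRegular` (`y² = x^p − t`). Composing with the projection
  `Z^{(q)} → Z` brings back (A): the projection is finite iff `[k : k^p] < ∞`.
* (C) DESCENT to a finitely generated (hence F-finite) field of definition `k₁ ⊆ k`, (A) over `k₁`,
  then base change `k₁ → k`: the base change of the regular `X̃₁` is regular iff (essentially)
  `k/k₁` is SEPARABLE (`…InseparableBaseChangeResolution`, evasion (i)). §4 below: there are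
  fields `k` with `[k : k^p] = ∞` and elements `a, b ∈ k` such that NO proper subfield containing
  `a, b` has `k` separable over it — so for data whose field of moduli contains `a, b` no F-finite
  field of definition with separable cofield exists, and (C) is dead for such `k`. (For
  `k = 𝔽_p(t₁, t₂, …)` (C) works: every finitely generated `k₀` lies in some `𝔽_p(t₁, …, t_n)`, over
  which `k` is purely transcendental.)
* (D) ABSTRACT regular target: PICover only needs SOME regular `Y`, separated of finite type over
  SOME field, and a finite radicial surjection `X̃ → Y` from a modification `X̃` of `X`; then
  `K(Y) ↪ K` with `K/K(Y)` finite purely inseparable. The candidates are `Z` re-embedded by a power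
  of Frobenius (`[K : K''^q] = ∞` unless F-finite — (A) again) or reduced twists of `Z` (not
  regular — (B) again); resolving `(Z^{(q)})_red` is a resolution problem of the same dimension.

Net: inside the summit's `∀ k` the item carries an open regime (`[k : k^p] = ∞`, `k` not separable
over any F-finite field of definition) in series with the genuine cruxes `Picover`/`Pialt`; it is
nevertheless summit-implied (§1), so it cannot be refuted without refuting the summit. The planners'
recorded repair (restate `Picover` with `IsIntegralHom g` and an independent finite-type structure
on `X`) removes the regime; that is a planner decision, not a disproof.

Load-bearing table (drop one hypothesis of `RadicialBottomAt p`, keep the rest):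
`IsIntegral X` — FALSE without it (§2, every prime); only generic reducedness matters
(`isIntegral_of_isReduced_of_surjective`). `IsIntegral X''` — possibly UNNECESSARY: `X''` is
homeomorphic to `X` (finite + universally injective + surjective), hence irreducible, and
`HasResolution X''` forces `X''` reduced on a dense open; the resolution `Z → X''` factors through
`X''_red`, which is integral, finite radicial surjective over `X`, and resolved by `Z` — so the
variant follows from the crux itself (paper; `X_red` is not in Mathlib). `IsFinite g`,
`UniversallyInjective g`, `Function.Surjective g.base`, `IsSeparated f`, `QuasiCompact f`,
`HasResolution X''`, `PicoverAt p` — each variant still concludes `HasResolution X` for an integral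
separated finite-type `X/k`, hence is summit-implied and UN-REFUTABLE short of `¬ summit`; dropping
`UniversallyInjective g` makes the consequent contain resolution of wild quotient singularities
`Y/G → Y/G` … (finite quotient maps `Y → Y/G`, `Y` regular), a different open problem.
`LocallyOfFiniteType f` — with `X''` of finite type over `k` it is automatic (Artin–Tate via the
finite `g`); genuinely non-Noetherian variants were not pursued. `p.Prime` — decoration modulo
`Hironaka1964` (`CharP k p` for a field forces `p` prime or `0`).
-/

/-! ## §4 Near-miss (paper-proved, not formalised): no F-finite subfield with separable cofield -/

/-- **Field obstruction to strategy (C).** For every prime `p` there are a field `k` of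
characteristic `p` with `[k : k^p] = ∞` and `a, b ∈ k` such that every subfield `k₁ ∋ a, b` over
which `k` is separable (encoded as injectivity of `Ω_{k₁/ℤ} ⊗_{k₁} k → Ω_{k/ℤ}`, which for field
extensions in characteristic `p` is equivalent to separability = vanishing of the imperfection
module, EGA 0_IV 20.6 / Jacobi–Zariski for `𝔽_p → k₁ → k`) is ALL of `k`; in particular no such
`k₁` is F-finite.

Paper proof. Let `K_N := 𝔽_p(x, y_N, z_1, …, z_N)` (purely transcendental, `N + 2` variables) and
embed `K_N ↪ K_{N+1}` by `y_N ↦ z_{N+1}^p − y_{N+1}^p·x` (the element is transcendental over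
`𝔽_p(x, z_1, …, z_{N+1})`, so this is an embedding); `k := ⋃_N K_N`, `a := x`, `b := y_0`. In `k`:
`z_{i+1}^p = y_i + y_{i+1}^p x` for all `i ≥ 0`. (1) `{x, z_1, z_2, …}` is `p`-independent in `k`
(it is part of the free generating set `{x, y_M, z_1, …, z_M}` of every `K_M`), so `[k : k^p] = ∞`
and `dx ≠ 0` in `Ω_k`. (2) Let `k₁ ∋ x, y_0` with `Ω_{k₁} ⊗ k → Ω_k` injective. Separability gives
`p`-radical closedness: `w ∈ k`, `w^p ∈ k₁ ⇒ w ∈ k₁` (else `(w ⊗ 1 − 1 ⊗ w)^p = 0 ≠ w ⊗ 1 − 1 ⊗ w`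
in `k ⊗_{k₁} k₁(w)`, Liu Ex. 3.2.12 / Mac Lane). Induction on `i`: if `x, y_i ∈ k₁` then
`d y_i + y_{i+1}^p dx = 0` in `Ω_k` (differentiate the relation), so the element
`dy_i ⊗ 1 + dx ⊗ y_{i+1}^p` of `Ω_{k₁} ⊗ k` maps to `0`, hence is `0`; as `dx ≠ 0` in `Ω_{k₁}`,
this forces `dy_i = c·dx` with `c ∈ k₁` and then `c = −y_{i+1}^p`, so `y_{i+1}^p ∈ k₁`, so
`y_{i+1} ∈ k₁`, so `z_{i+1} ∈ k₁` (`z_{i+1}^p ∈ k₁`). Hence `k₁ ⊇ 𝔽_p(x, y_i, z_i : i) = k`. ∎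

Consequence for the crux: for data `(X, X'', g, Z)` over this `k` whose field of moduli contains
`a, b`, every field of definition `k₁` with `k/k₁` separable is `k` itself, which is not F-finite;
strategy (C) of §3 is unavailable, and (A), (B), (D) die on `[k : k^p] = ∞`.

Nearest print: Mac Lane, *Modular fields I. Separating transcendence bases*, Duke Math. J. 5
(1939) (p-bases; the criterion "K/k separable iff p-independent subsets of k stay p-independent in
K"); EGA 0_IV §20.6, §21.4 (imperfection module, Cartier's equality). The tower itself: folklore-style
construction of this seat (lit search degraded this session: local FTS db unavailable, OpenAlex/S2 429).

Lean status: `sorry` — Mathlib has neither `p`-bases nor separability of transcendental extensions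
nor differential bases of purely transcendental extensions; formalising (1)–(2) is a project of its
own and proves nothing about the crux AS STATED (it constrains a proof strategy). [folklore] -/
theorem exists_field_no_FFinite_separable_subfield (p : ℕ) [Fact p.Prime] :
    ∃ (k : Type) (_ : Field k) (_ : CharP k p) (a b : k),
      ¬ FiniteDimensional (frobenius k p).fieldRange k ∧
      ∀ k₁ : Subfield k, a ∈ k₁ → b ∈ k₁ →
        Function.Injective (KaehlerDifferential.mapBaseChange ℤ k₁ k) → k₁ = ⊤ := by
  sorry

end Summit.ResolutionOfSingularities.ResolutionOfSingularities.Cruxes.PicoverToRadicialBottom.Disproof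

end
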